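import Summits.QuantumFields.QCD.Theorems.WilsonMobilityGapMobilityGapPointwiseCombesThomas
import Summits.QuantumFields.QCD.Theorems.WilsonMobilityGapMobilityGapWilsonPointwiseCoercive
import Literature.MathematicalPhysics.QuantumLattice.WilsonDiracRangeOne
import Literature.MathematicalPhysics.QuantumFieldTheory.QCDHeavyQuarkPropagator

/-!
# Deterministic localisation of the Wilson quark propagator at positive, lattice-light bare mass
# (helper for crux `MobilityGap`, stmt-QuantumFields-9150, line `Sketch`; lead c5, 2026-08-16)

**Configuration-wise.**  There is an absolute constant `K` such that for EVERY `SU(3)` gauge field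
`U` on the four-torus `(ℤ/L)⁴`, every bare mass `0 < m ≤ 1` with `m L⁴ ≥ 1`, and all indices
`p, q`, the `r = 1` Wilson–Dirac matrix `D = D_W(U, m, 1)` is invertible and

  `|D⁻¹(p, q)| ≤ K · exp(−(m/400) · torusDist p.1 q.1)`

(`norm_inv_wilsonDirac_apply_le_of_pos`).  Rate `≍ m` as in the hopping expansion, but — the
point — amplitude `K` UNIFORM in the field, in the volume and in `m ↓ 0`, where the hopping /
Neumann bounds of the tree (`norm_inv_wilsonDirac_apply_le`, amplitude `(1 − 4/(m+4))⁻¹/(m+4) ≍ 1/m`)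
and the accretive Combes–Thomas bound (`accretive_combes_thomas`, amplitude `2/m`) degenerate.
Mechanism: the pointwise coercivity `|v_p|²/K + (m/2)‖v‖² ≤ Re⟨v, Dv⟩` of
`…MobilityGapWilsonPointwiseCoercive` (Wilson positivity + Kato + four-torus Sobolev + the `d = 4`
Green constant, all landed for crux `TipNoBinding`) fed into the pointwise-coercive Combes–Thomas
bound of `…MobilityGapPointwiseCombesThomas`, with the range-one geometry and the off-site row/column
sums `≤ 96` of `D_W` in the periodic `ℓ^∞` distance (`Literature/…/WilsonDiracRangeOne`).

**Phase-quenched.**  Integrated against the non-negative weight `|det diracMatrix|` exactly as in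
the tree's `ThickCollarFarStability.stub_hopping` (`fm_le_of_pos_mass`): for every `N_f`, `β`, bare
tuple `mq`, flavour `f` with `0 < mq f ≤ 1`, every `S` with `mq f · (2S+1)⁴ ≥ 1`, every `s ∈ (0,1)`
and every `v ∈ box 4 S`, the crux's ratio of integrals is `≤ C · exp(−(mq f/400) · s · ‖v‖∞)`.

Consequence for the crux (drawn in `…MobilityGapLightWitness`): along ANY trajectory of positive
bare masses `m_f(k) ≥ c a_k` on tori of side `≥ a_k⁻¹`, clause (ii) of `MobilityGap` holds
deterministically at the physical-form rate `(c s/400) · a_k` with a `k`-uniform constant.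
Pure theorem file (no definitions).
-/

noncomputable section

namespace Summit.QuantumFields.QCD.Theorems.MobilityGapPositiveMass

open scoped BigOperators
open MeasureTheory Matrix Finset
open Literature.MathematicalPhysics.QuantumFieldTheory Literature.MathematicalPhysics.QuantumLattice
  Literature.Probability.LatticeModels

/-! ### The configuration-wise bound -/

/-- **Deterministic exponential decay of the Wilson quark propagator at positive bare mass, with a
uniform amplitude.**  There is `K > 0` such that for every torus side `L`, every `SU(3)` gauge field
`U`, every bare mass `0 < m ≤ 1` with `1 ≤ m L⁴`: `det D_W(U,m,1) ≠ 0` and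
`|D_W(U,m,1)⁻¹(p,q)| ≤ K exp(−(m/400)·torusDist p.1 q.1)` for all `p, q`.
(Pointwise coercivity + pointwise-coercive Combes–Thomas with `h = 96`, `θ = m/400`:
`96(e^θ − 1) ≤ 192 θ < m/2`.) [folklore] -/
theorem norm_inv_wilsonDirac_apply_le_of_pos :
    ∃ K : ℝ, 0 < K ∧ ∀ (L : ℕ) [NeZero L] (U : GaugeConfig 4 L (Matrix.specialUnitaryGroup (Fin 3) ℂ))
      (m : ℝ), 0 < m → m ≤ 1 → 1 ≤ m * (L : ℝ) ^ 4 →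
        (wilsonDirac (fundamentalRep (Fin 3)) U m 1).det ≠ 0 ∧
        ∀ p q : TorusSite 4 L × Fin 3 × Fin 4,
          ‖(wilsonDirac (fundamentalRep (Fin 3)) U m 1)⁻¹ p q‖ ≤
            K * Real.exp (-(m / 400 * (torusDist p.1 q.1 : ℝ))) := by
  obtain ⟨K, hK, hpc⟩ := wilson_pointwise_coercive
  refine ⟨K, hK, ?_⟩
  intro L _ U m hm hm1 hmL
  classical
  have hρ : ∀ g : Matrix.specialUnitaryGroup (Fin 3) ℂ,
      fundamentalRep (Fin 3) g ∈ Matrix.unitaryGroup (Fin 3) ℂ := fundamentalRep_mem_unitaryGroup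
  set A := wilsonDirac (fundamentalRep (Fin 3)) U m 1 with hA
  -- the rate
  set θ : ℝ := m / 400 with hθ
  have hθ0 : 0 ≤ θ := by positivity
  have hθ1 : |θ| ≤ 1 := by rw [abs_of_nonneg hθ0, hθ]; linarith
  have hη : (32 * ((3 : ℕ) : ℝ)) * (Real.exp θ - 1) ≤ m / 2 := by
    have h1 : Real.exp θ - 1 ≤ 2 * |θ| := (le_abs_self _).trans (Real.abs_exp_sub_one_le hθ1)
    rw [abs_of_nonneg hθ0] at h1
    have h2 : (32 * ((3 : ℕ) : ℝ)) * (Real.exp θ - 1) ≤ 96 * (2 * θ) := by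
      push_cast
      nlinarith
    rw [hθ] at h2
    linarith
  have hct := pointwise_coercive_combes_thomas
    (fun p q : TorusSite 4 L × Fin 3 × Fin 4 => torusDist p.1 q.1)
    (fun p => torusDist_self p.1) (fun p q => torusDist_comm' p.1 q.1)
    (fun p q r => torusDist_triangle' p.1 q.1 r.1) A
    (fun p q h => torusDist_le_one_of_wilsonDirac_ne_zero (fundamentalRep (Fin 3)) hρ U m p q h)
    (32 * ((3 : ℕ) : ℝ))
    (fun p => wilsonDirac_rowSum_torusDist_le (fundamentalRep (Fin 3)) hρ U m p)
    (fun q => wilsonDirac_colSum_torusDist_le (fundamentalRep (Fin 3)) hρ U m q)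
    K (m / 2) θ hK (by positivity) hθ0
    (fun v p => hpc L U m hm hmL v p) hη
  refine ⟨hct.1.ne_zero, fun p q => ?_⟩
  have h := hct.2 p q
  rwa [hθ] at h

/-! ### Geometry of the odd torus: the box is a fundamental domain -/

/-- For `v ∈ {-S,…,S}⁴` the periodic `ℓ^∞` distance on the torus of side `2S+1` from the class of
`0` to the class of `v` dominates the sup norm `‖v‖`. [folklore] -/
theorem norm_le_torusDist_proj (S : ℕ) (v : Literature.Probability.LatticeModels.Site 4)
    (hv : v ∈ box 4 S) :
    ‖v‖ ≤ (torusDist (Torus.proj (2 * S + 1) (0 : Literature.Probability.LatticeModels.Site 4))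
      (Torus.proj (2 * S + 1) v) : ℝ) := by
  -- a maximal coordinate
  obtain ⟨i₀, -, hmax⟩ :=
    Finset.exists_max_image Finset.univ (fun i : Fin 4 => ‖v i‖) Finset.univ_nonempty
  have hvi : ∀ i, |v i| ≤ (S : ℤ) := fun i => by
    have := Fintype.mem_piFinset.1 hv i
    rw [Finset.mem_Icc] at this
    exact abs_le.2 ⟨by linarith [this.1], this.2⟩
  have hnorm : ‖v‖ ≤ ((v i₀).natAbs : ℝ) := by
    have h1 : ‖v‖ ≤ ‖v i₀‖ :=
      (pi_norm_le_iff_of_nonneg (norm_nonneg _)).2 fun i => hmax i (Finset.mem_univ i)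
    rw [Int.norm_eq_abs] at h1
    rw [Nat.cast_natAbs, Int.cast_abs]
    exact h1
  refine hnorm.trans ?_
  have hproj0 : Torus.proj (2 * S + 1) (0 : Literature.Probability.LatticeModels.Site 4) = 0 := by
    funext i; simp [Torus.proj]
  rw [hproj0, torusDist, zero_sub, torusNorm_neg]
  have hle : (v i₀).natAbs ≤ torusNorm (Torus.proj (2 * S + 1) v) := by
    unfold torusNorm
    have h := Finset.le_sup (f := fun i : Fin 4 => min ((Torus.proj (2 * S + 1) v) i).val
      (2 * S + 1 - ((Torus.proj (2 * S + 1) v) i).val)) (Finset.mem_univ i₀)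
    have hc : min ((Torus.proj (2 * S + 1) v) i₀).val (2 * S + 1 - ((Torus.proj (2 * S + 1) v) i₀).val) =
        (v i₀).natAbs := by
      rw [Torus.proj_apply]
      exact cyclicAbs_intCast_eq_natAbs S (v i₀) (hvi i₀)
    rw [hc] at h
    exact h
  exact_mod_cast hle

/-! ### The phase-quenched fractional moment at positive lattice-light mass -/

/-- **Phase-quenched `s`-moment decay at positive, lattice-light bare mass** (the measure-theoretic
template is the tree's `ThickCollarFarStability.stub_hopping`): there are `C, c > 0` (`c = 1/400`)
such that for every `N_f`, every coupling `β`, every bare tuple `mq` and flavour `f` with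
`0 < mq f ≤ 1`, every `S` with `1 ≤ mq f · (2S+1)⁴`, every `s ∈ (0,1)` and every `v ∈ box 4 S`, the
`|det diracMatrix|`-reweighted Wilson average of `(Σ_{a,i,b,j} |(diracMatrix U mq)⁻¹((f,0,a,i),(f,v,b,j))|)^s`
on the torus of side `2S+1` is `≤ C · exp(−c · mq f · s · ‖v‖)`.  Configurations where some other
flavour's Wilson matrix is singular carry weight `|det| = 0`. [folklore] -/
theorem fm_le_of_pos_mass :
    ∃ C c : ℝ, 0 < C ∧ 0 < c ∧ ∀ (Nf : ℕ) (β : ℝ) (mq : Fin Nf → ℝ) (f : Fin Nf), 0 < mq f → mq f ≤ 1 →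
      ∀ S : ℕ, 1 ≤ mq f * ((2 * S + 1 : ℕ) : ℝ) ^ 4 → ∀ s : ℝ, 0 < s → s < 1 →
        ∀ v : Literature.Probability.LatticeModels.Site 4, v ∈ box 4 S →
          (∫ U : GaugeConfig 4 (2 * S + 1) (Matrix.specialUnitaryGroup (Fin 3) ℂ),
              ‖(diracMatrix U mq).det‖ *
                (∑ a : Fin 3, ∑ i : Fin 4, ∑ b : Fin 3, ∑ j : Fin 4,
                  ‖(diracMatrix U mq)⁻¹ (quarkEquiv (f, (Torus.proj (2 * S + 1) 0, a, i)))
                    (quarkEquiv (f, (Torus.proj (2 * S + 1) v, b, j)))‖) ^ s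
              ∂(wilsonMeasure (fundamentalRep (Fin 3)) β)) /
            (∫ U : GaugeConfig 4 (2 * S + 1) (Matrix.specialUnitaryGroup (Fin 3) ℂ),
              ‖(diracMatrix U mq).det‖ ∂(wilsonMeasure (fundamentalRep (Fin 3)) β)) ≤
          C * Real.exp (-(c * mq f * s * ‖v‖)) := by
  obtain ⟨K, hK, hdec⟩ := norm_inv_wilsonDirac_apply_le_of_pos
  refine ⟨max (144 * K) 1, 1 / 400, by positivity, by norm_num, ?_⟩
  intro Nf β mq f hm0 hm1 S hvol s hs0 hs1 v hv
  set m : ℝ := mq f with hmdef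
  -- the volume condition in the form consumed by the configuration-wise bound
  have hvol' : 1 ≤ m * (((2 * S + 1 : ℕ)) : ℝ) ^ 4 := hvol
  -- entry bound at configurations where every flavour is invertible
  set E : ℝ := Real.exp (-(m / 400 * ‖v‖)) with hE
  have hEpos : 0 < E := Real.exp_pos _
  have hdist := norm_le_torusDist_proj S v hv
  have hentry : ∀ U : GaugeConfig 4 (2 * S + 1) SU3,
      (∀ g, (wilsonDirac (fundamentalRep (Fin 3)) U (mq g) 1).det ≠ 0) →
      ∀ (a' : Fin 3) (i : Fin 4) (b : Fin 3) (j : Fin 4),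
        ‖(diracMatrix U mq)⁻¹ (quarkEquiv (f, (Torus.proj (2 * S + 1) 0, a', i)))
          (quarkEquiv (f, (Torus.proj (2 * S + 1) v, b, j)))‖ ≤ K * E := by
    intro U hA a' i b j
    rw [inv_diracMatrix_apply_same_flavour U mq hA]
    have h := ((hdec (2 * S + 1) U m hm0 hm1 hvol').2 (Torus.proj (2 * S + 1) 0, a', i)
      (Torus.proj (2 * S + 1) v, b, j))
    refine h.trans (mul_le_mul_of_nonneg_left (Real.exp_le_exp.2 ?_) hK.le)
    have : m / 400 * ‖v‖ ≤ m / 400 * (torusDist (Torus.proj (2 * S + 1)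
        (0 : Literature.Probability.LatticeModels.Site 4)) (Torus.proj (2 * S + 1) v) : ℝ) :=
      mul_le_mul_of_nonneg_left hdist (by positivity)
    linarith
  have hsum : ∀ U : GaugeConfig 4 (2 * S + 1) SU3,
      (∀ g, (wilsonDirac (fundamentalRep (Fin 3)) U (mq g) 1).det ≠ 0) →
      (∑ a' : Fin 3, ∑ i : Fin 4, ∑ b : Fin 3, ∑ j : Fin 4,
        ‖(diracMatrix U mq)⁻¹ (quarkEquiv (f, (Torus.proj (2 * S + 1) 0, a', i)))
          (quarkEquiv (f, (Torus.proj (2 * S + 1) v, b, j)))‖) ≤ 144 * (K * E) := by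
    intro U hA
    calc _ ≤ ∑ _a' : Fin 3, ∑ _i : Fin 4, ∑ _b : Fin 3, ∑ _j : Fin 4, K * E :=
          Finset.sum_le_sum fun a' _ => Finset.sum_le_sum fun i _ => Finset.sum_le_sum fun b _ =>
            Finset.sum_le_sum fun j _ => hentry U hA a' i b j
      _ = 144 * (K * E) := by simp; ring
  -- the uniform bound `B₀` on the fractional power of the sum
  set B₀ : ℝ := max (144 * K) 1 * Real.exp (-(1 / 400 * mq f * s * ‖v‖)) with hB₀
  have hB₀0 : 0 ≤ B₀ := by rw [hB₀]; positivity
  have hB : (144 * (K * E)) ^ s ≤ B₀ := by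
    have h1 : 144 * (K * E) = (144 * K) * E := by ring
    rw [h1, Real.mul_rpow (by positivity) hEpos.le, hB₀]
    refine mul_le_mul ?_ ?_ (by positivity) (by positivity)
    · -- `(144K)^s ≤ max(144K, 1)`
      rcases le_or_gt (144 * K) 1 with hle | hlt
      · calc (144 * K) ^ s ≤ (1 : ℝ) ^ s := Real.rpow_le_rpow (by positivity) hle hs0.le
          _ = 1 := Real.one_rpow s
          _ ≤ max (144 * K) 1 := le_max_right _ _
      · calc (144 * K) ^ s ≤ (144 * K) ^ (1 : ℝ) :=
            Real.rpow_le_rpow_of_exponent_le hlt.le hs1.le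
          _ = 144 * K := Real.rpow_one _
          _ ≤ max (144 * K) 1 := le_max_left _ _
    · rw [hE, ← Real.exp_mul]
      apply Real.exp_le_exp.2
      have : -(m / 400 * ‖v‖) * s = -(1 / 400 * mq f * s * ‖v‖) := by rw [hmdef]; ring
      rw [this]
  -- pointwise bound of the integrand (singular configurations carry zero weight)
  have hpt : ∀ U : GaugeConfig 4 (2 * S + 1) SU3,
      ‖(diracMatrix U mq).det‖ *
        (∑ a' : Fin 3, ∑ i : Fin 4, ∑ b : Fin 3, ∑ j : Fin 4,
          ‖(diracMatrix U mq)⁻¹ (quarkEquiv (f, (Torus.proj (2 * S + 1) 0, a', i)))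
            (quarkEquiv (f, (Torus.proj (2 * S + 1) v, b, j)))‖) ^ s ≤
        ‖(diracMatrix U mq).det‖ * B₀ := by
    intro U
    by_cases hA : ∀ g, (wilsonDirac (fundamentalRep (Fin 3)) U (mq g) 1).det ≠ 0
    · exact mul_le_mul_of_nonneg_left
        ((Real.rpow_le_rpow (by positivity) (hsum U hA) hs0.le).trans hB) (norm_nonneg _)
    · have h0 : ‖(diracMatrix U mq).det‖ = 0 := by
        push Not at hA
        obtain ⟨g, hg⟩ := hA
        rw [norm_det_diracMatrix]
        exact Finset.prod_eq_zero (Finset.mem_univ g) (by rw [norm_eq_zero]; exact hg)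
      rw [h0, zero_mul, zero_mul]
  have hnum : (∫ U : GaugeConfig 4 (2 * S + 1) SU3, ‖(diracMatrix U mq).det‖ *
      (∑ a' : Fin 3, ∑ i : Fin 4, ∑ b : Fin 3, ∑ j : Fin 4,
        ‖(diracMatrix U mq)⁻¹ (quarkEquiv (f, (Torus.proj (2 * S + 1) 0, a', i)))
          (quarkEquiv (f, (Torus.proj (2 * S + 1) v, b, j)))‖) ^ s
      ∂(wilsonMeasure (fundamentalRep (Fin 3)) β)) ≤
      (∫ U : GaugeConfig 4 (2 * S + 1) SU3, ‖(diracMatrix U mq).det‖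
        ∂(wilsonMeasure (fundamentalRep (Fin 3)) β)) * B₀ := by
    rw [← integral_mul_const]
    refine integral_mono_of_nonneg (Filter.Eventually.of_forall fun U => ?_)
      ((integrable_norm_det_diracMatrix mq _).mul_const B₀) (Filter.Eventually.of_forall fun U => hpt U)
    exact mul_nonneg (norm_nonneg _) (Real.rpow_nonneg (by positivity) _)
  have hZ0 : 0 ≤ ∫ U : GaugeConfig 4 (2 * S + 1) SU3, ‖(diracMatrix U mq).det‖
      ∂(wilsonMeasure (fundamentalRep (Fin 3)) β) := integral_nonneg fun U => norm_nonneg _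
  rcases hZ0.eq_or_lt with hZ | hZ
  · rw [← hZ, div_zero]
    exact hB₀0
  · rw [div_le_iff₀ hZ]
    exact hnum.trans_eq (mul_comm _ _)

end Summit.QuantumFields.QCD.Theorems.MobilityGapPositiveMass

end
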